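/-
Copyright (c) 2026 the pub-hodgecm-mathlib formalisation cell (harness21).  Prover seat hodgecm-mathlib-LH4-p11 (g11), req620 Track A «(D-RAM) FOUR-FRAME» squad
(STAGE-1b, row (2) of the piece `f_{T₊}`, the (β₂) road (R-36), the K6 road; K6 desk LH4-p16 (g3) WORD #2 (β) «p11: K6-(g) THE WINDOW CHARACTER SUM VANISHES» + WORD #5
(the radius-general shape) — the ONE arithmetic input `hω : Σ_{V ∈ B} ω V = 0` of ★ p864409 `…CoreOfPerCellLaws.coreWindow_of_perCellLaws ∕ coreWindow_of_cellValues`), 2026-09-05.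
-/
import Literature.NumberTheory.LocalFields.WildQuadraticDatumNormSignConductor   -- ★ (LH4-p06 (g3)) the ω-conductor toolkit: `sum_normSign_repr_eq_zero` (the non-norm involution); brings ★ `IsRamifiedQuadraticDatum`, `normSign`
import HarnessLib

/-!
# Crux `H413`, line LH4 «(D-RAM) FOUR-FRAME» — STAGE-1b, row (2), the (β₂) road (R-36), K6-(g): «THE WINDOW CHARACTER SUM VANISHES» — the affine label character
# `V ↦ ω(α₁ + γ₁·V)` sums to zero over a complete irredundant digit system of ANY fixed ball whose image ball `α₁(1 + 𝔭_F^{c+e})` lies strictly inside the units and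
# reaches below the conductor, at any resolution resolving the conductor

Cell `hodgecm-mathlib` (D-0151), FLOOR 0, crux item H413 = `stmt-HodgeConjecture-24833`, route of record `HCCMUnconditional`; squad F0∕P3c∕LH4; lane
`--supports stmt-HodgeConjecture-24833 --as helper` (count-neutral; pays NO tier-0 row).  THEOREMS ONLY (no `def`, no instance, no notation, no `sorry`, default heartbeats);
★-only imports; states NO law; (β₂) stays a HYPOTHESIS.  ONE-FIELD local arithmetic of a ramified quadratic datum `(σ, ϖ; d, t)` on a complete `K` with finite residue field
(`F = K^σ` the fixed elements, `|ϖ_F| = |ϖ|²`, `ω = normSign σ`, `U_F(k)` = fixed units `u` with `|u − 1| ≤ |ϖ|^k`); nothing about lattices, no chart, no second field.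

WHAT (K6 desk LH4-p16 (g3) WORD #2 (β) + WORD #5; MECH-K3 v1 `F0/P3c/LH4/LH4-p16/g2/MECH-K3.v1.LH4p16g2.md` §4 «CORE ⟺ the ramified character sums to zero over `α₁(1 + 𝔭_F)`»).  The
abstract CORE arithmetic ★ p864238 `…CoreWindowOfDigitSums.sum_window_eq_sum_window_of_perCellLaw` ∕ ★ p864409 `…CoreOfPerCellLaws.coreWindow_of_perCellLaws`, `coreWindow_of_cellValues`
has ONE arithmetic input `hω : Σ_{V ∈ B} ω V = 0`, where `B` is the digit set of the INSIDE window cells of the live row and `ω V := normSign σ (α₁ + γ₁·V)` is the affine label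
character of the row (`α₁, γ₁` `σ`-fixed, `|α₁| = 1`, `|γ₁| = |ϖ|^{2c}`; ★ p862927 `exists_affineLabel_of_coords_any`, ★ M1 p863628 `haff`).  In the row's TOP chart (★ p864361 §7,
`|ξ₀| = exp 2N`) the inside cells `i ≤ N − 1` carry exactly the digit BALL `|V| ≤ |ϖ|²` (`e = 1`, `c = 0`); in the INSIDE chart `|ξ₀′| = exp 2(N − 1)` they carry the whole unit
ball (`e = 0`, `c = 1`); either way the image of the ball under `V ↦ α₁ + γ₁V` is the coset ball `α₁·(1 + 𝔭_F^{c+e})` with `c + e = 1`.  THIS FILE proves, RADIUS-GENERAL and CHART-FREE: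
**for `1 ≤ c + e` (the image ball is strictly inside `α₁`'s unit level) and `c + e + 1 ≤ d` (it reaches the shell `U_F(2d−2)` below the conductor) and any resolution `|ϖ|^n` with
`2d − 1 ≤ 2c + n` (the label is a digit-class function), over every complete irredundant system `D` of representatives of the fixed ball `|V| ≤ |ϖ|^{2e}` modulo `|ϖ|^n`:
`Σ_{V ∈ D} ω(α₁ + γ₁·V) = 0`** — the values `α₁ + γ₁V`, `V ∈ D`, form a complete irredundant system of representatives modulo `𝔭^{2c+n}` of `{y fixed : |y − α₁| ≤ |ϖ|^{2(c+e)}}`, a set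
of fixed units stable under `U_F(2d−2)`, so ★ `sum_normSign_repr_eq_zero` (the non-norm involution `y ↦ c₀·y`, `c₀ ∈ U_F(2d−2) ∖ N(Kˣ)`) kills the sum (LH4-p14's ★
`…BinaryNormFormFixedSums.sum_normSign_affine_repr_eq_zero` pattern with SHELL ↦ BALL, `j + 2 ≤ d` ↦ `c + e + 1 ≤ d`, resolution free).
* §1 `sum_normSign_affine_ballSystem_eq_zero` — THE ENGINE in valuation letters (`R, r : ℤᵐ⁰`: `|γ₁|·R < 1`, `exp(−2(d−1)) ≤ |γ₁|·R`, `0 ≠ r`, `|γ₁|·r ≤ |ϖ|^{2d−1}`; `D` fixed,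
  inside the ball `R`, complete and irredundant for the ball modulo `r`) — serves an `r`-lettered socket (★ p863833's `Rd`, `r`) as well.
* §2 HEAD `sum_normSign_affine_ballDigits_eq_zero` — the K6 desk's bytes (WORD #5): `|γ₁| = |ϖ|^{2c}`, `1 ≤ c + e`, `c + e + 1 ≤ d`, `2d − 1 ≤ 2c + n`, `D` a complete irredundant
  system of the ball `|V| ≤ |ϖ|^{2e}` modulo `|ϖ|^n` ⟹ `Σ_{V ∈ D} normSign σ (α₁ + γ₁ * V) = 0`.
* §3 COROLLARY `sum_normSign_affine_filterBall_eq_zero` — in the socket's `Rd` letters (`hRd1 hRd2 hRd3`: fixed integral digits, complete and irredundant modulo `|ϖ|^n` on the unit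
  ball) with `2e ≤ n`: `Σ_{V ∈ Rd.filter (|V| ≤ |ϖ|^{2e})} normSign σ (α₁ + γ₁ * V) = 0` — ★ p864409 HEAD₂'s `hω` at `B := Rd.filter (|·| ≤ |ϖ|^{2e})` in EITHER chart (top: `e = 1`,
  `c = 0`; inside: `e = 0`, `c = 1`, where `Rd.filter (|·| ≤ 1) = Rd`).
WHAT IS NOT CLAIMED: which digits are labelled ∕ literal (★ p863983, K6-(d) ★ p864361, (d′) LH7-p08 (g3)), the per-cell law (★ p864195), the uniform density (‹K6-(f)›, ★ p864349),
the character-sum VALUES on single shells (★ LH4-p14), the chart rescaling of `γ₁` (the assembler's), any census identity; ‹CORE›∕‹CORE-3›∕‹CORE-ODD› and (β₂) remain HYPOTHESES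
of their consumers.
HONEST LABEL.  Count-neutral local arithmetic; nothing printed is asserted; no census law is stated; `HC_CM` is proved only modulo the 7 printed citations (2 remaining named inputs:
hLiu418 = `stmt-HodgeConjecture-24832`, h413 = `stmt-HodgeConjecture-24833`) until rung 0 closes.
## References
* [Serre1979] J.-P. Serre, *Local Fields*, GTM 67 (1979): Ch. V §3 Prop. 5, Cor. 2–3 pp. 84–86 (norm groups of a totally ramified quadratic extension; the conductor), Ch. XV §2
  (the conductor via `U^{(n)}`; a non-trivial character sums to zero over the cosets on which it is non-trivial).
* [NeukirchANT1999] J. Neukirch, *Algebraic Number Theory* (1999): Ch. V (1.3) (local norm index two).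
* [Kottwitz1986BaseChangeUnits] R. E. Kottwitz, *Base change for unit elements of Hecke algebras*, Compositio Math. 60 (1986): §1 pp. 240–241 (cell-by-cell lattice bookkeeping).
* [Rogawski1990] J. D. Rogawski, *Automorphic Representations of Unitary Groups in Three Variables*, Ann. of Math. Stud. 123 (1990): §4.9 Prop. 4.9.1 (b) p. 55 (the labelled census).
-/

set_option autoImplicit false

noncomputable section

namespace Summit.HodgeConjecture.HodgeConjecture.Cruxes.H413.F0P3cDyRamWindowLabelSumVanishes

open WithZero Finset
open scoped Valued
open Literature.NumberTheory.Automorphic.UnitaryThreeFourFrame (IsRamifiedQuadraticDatum normSign)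
open Literature.NumberTheory.LocalFields.WildQuadraticDatum (sum_normSign_repr_eq_zero)

variable {K : Type} [Field K] [Valued K ℤᵐ⁰] {σ : K →+* K} {ϖ : K} {d t : ℕ}

/-! ## §1 The engine: the affine image of a representative system of a ball reaching the shell `U_F(2d−2)` is a representative system of a `U_F(2d−2)`-stable set of units -/

/-- **THE ENGINE — «AN AFFINE LABEL CHARACTER SUMS TO ZERO OVER A REPRESENTATIVE SYSTEM OF A BALL THAT REACHES THE CONDUCTOR».**  Ramified quadratic datum `(σ, ϖ; d, t)` on a
complete `K` with finite residue field, `|2| < 1`; `α₁, γ₁` fixed with `|α₁| = 1`; a radius `R` and a resolution `r ≠ 0` (both in the value group) with: `|γ₁|·R < 1` (the values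
`α₁ + γ₁V`, `|V| ≤ R`, stay on `α₁`'s unit coset), `exp(−2(d−1)) ≤ |γ₁|·R` (the coset ball `{y fixed : |y − α₁| ≤ |γ₁|·R}` is stable under `U_F(2d−2)` — it REACHES the shell below
the conductor), `|γ₁|·r ≤ |ϖ|^{2d−1}` (the modulus `𝔭^ρ`, `|ϖ|^ρ = |γ₁|·r`, resolves the conductor: `ρ ≥ 2d − 1`); a finite set `D` of fixed elements of the ball `|V| ≤ R` which is
COMPLETE (`hD2`) and IRREDUNDANT (`hD3`) for the fixed elements of that ball modulo `r`.  THEN **`Σ_{V ∈ D} ω(α₁ + γ₁·V) = 0`** (`ω = normSign σ`): `V ↦ α₁ + γ₁V` maps `D` injectively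
onto a complete irredundant system of representatives modulo `𝔭^ρ` of the coset ball, and ★ `sum_normSign_repr_eq_zero` applies.
[cite: Serre1979, Ch. V §3 Cor. 3 pp. 84–86; Ch. XV §2] [cite: NeukirchANT1999, Ch. V (1.3)] -/
theorem sum_normSign_affine_ballSystem_eq_zero [CompleteSpace K] [Finite 𝓀[K]] (hD : IsRamifiedQuadraticDatum σ ϖ d t) (h2v : Valued.v (2 : K) < 1)
    {α₁ γ₁ : K} (hσα₁ : σ α₁ = α₁) (hα₁ : Valued.v α₁ = 1) (hσγ₁ : σ γ₁ = γ₁)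
    {R r : ℤᵐ⁰} (hunit : Valued.v γ₁ * R < 1) (hreach : exp (-(2 * ((d - 1 : ℕ) : ℤ))) ≤ Valued.v γ₁ * R)
    (hr0 : r ≠ 0) (hprec : Valued.v γ₁ * r ≤ Valued.v ϖ ^ (2 * d - 1))
    (D : Finset K) (hD1 : ∀ V ∈ D, σ V = V ∧ Valued.v V ≤ R)
    (hD2 : ∀ V : K, σ V = V → Valued.v V ≤ R → ∃ V₀ ∈ D, Valued.v (V - V₀) ≤ r)
    (hD3 : ∀ V ∈ D, ∀ V' ∈ D, Valued.v (V - V') ≤ r → V = V') :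
    ∑ V ∈ D, normSign σ (α₁ + γ₁ * V) = 0 := by
  classical
  obtain ⟨-, -, hϖ, -, -, -, -⟩ := id hD
  -- non-vanishing letters
  have hγR0 : Valued.v γ₁ * R ≠ 0 := by
    intro h0
    have h1 := lt_of_lt_of_le (zero_lt_iff.2 (exp_ne_zero (a := -(2 * ((d - 1 : ℕ) : ℤ))))) hreach
    rw [h0] at h1
    exact lt_irrefl _ h1
  have hγ0 : Valued.v γ₁ ≠ 0 := fun h => hγR0 (by rw [h, zero_mul])
  have hγ0' : γ₁ ≠ 0 := fun h => hγ0 (by rw [h, map_zero])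
  have hγpos : 0 < Valued.v γ₁ := zero_lt_iff.2 hγ0
  have hpow : ∀ n : ℕ, Valued.v ϖ ^ n = exp (-(n : ℤ)) := fun n => by
    rw [hϖ, ← exp_nsmul, nsmul_eq_mul, mul_neg, mul_one]
  -- the modulus `ρ`: `|ϖ|^ρ = |γ₁|·r`, `ρ ≥ 2d − 1`
  obtain ⟨ρ, hρ, hρeq⟩ : ∃ ρ : ℕ, 2 * d - 1 ≤ ρ ∧ Valued.v ϖ ^ ρ = Valued.v γ₁ * r := by
    have hx0 : Valued.v γ₁ * r ≠ 0 := mul_ne_zero hγ0 hr0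
    have hle : log (Valued.v γ₁ * r) ≤ -((2 * d - 1 : ℕ) : ℤ) := by
      rw [log_le_iff_le_exp hx0, ← hpow]; exact hprec
    refine ⟨(-log (Valued.v γ₁ * r)).toNat, by omega, ?_⟩
    rw [hpow, Int.toNat_of_nonneg (by omega), neg_neg, exp_log hx0]
  -- the coset ball of values and its stability under `U_F(2d−2)`
  set A : Set K := {y | σ y = y ∧ Valued.v (y - α₁) ≤ Valued.v γ₁ * R} with hAdef
  have hAu : ∀ f ∈ A, σ f = f ∧ Valued.v f = 1 := by
    rintro f ⟨hσf, hf⟩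
    refine ⟨hσf, ?_⟩
    have hlt : Valued.v (f - α₁) < Valued.v α₁ := by rw [hα₁]; exact hf.trans_lt hunit
    rw [show f = α₁ + (f - α₁) by ring, Valuation.map_add_eq_of_lt_left _ hlt, hα₁]
  have hAst : ∀ f ∈ A, ∀ a : K, σ a = a → Valued.v a = 1 → Valued.v (a - 1) ≤ exp (-(2 * ((d - 1 : ℕ) : ℤ))) → a * f ∈ A := by
    rintro f ⟨hσf, hf⟩ a hσa ha1 had
    refine ⟨by rw [map_mul, hσa, hσf], ?_⟩
    have e : a * f - α₁ = a * (f - α₁) + α₁ * (a - 1) := by ring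
    rw [e]
    refine (Valuation.map_add _ _ _).trans (max_le ?_ ?_)
    · rw [map_mul, ha1, one_mul]; exact hf
    · rw [map_mul, hα₁, one_mul]; exact had.trans hreach
  -- the representative map `V ↦ α₁ + γ₁·V`
  let g : K → K := fun V => α₁ + γ₁ * V
  have hg_inj : Set.InjOn g ↑D := by
    intro a _ a' _ h
    have h' : α₁ + γ₁ * a = α₁ + γ₁ * a' := h
    exact mul_left_cancel₀ hγ0' (add_left_cancel h')
  set S : Finset K := D.image g with hSdef
  have hS1 : ∀ y ∈ S, y ∈ A := by
    intro y hy
    obtain ⟨V, hV, rfl⟩ := mem_image.1 hy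
    obtain ⟨hσV, hVR⟩ := hD1 V hV
    refine ⟨by simp only [g, map_add, map_mul, hσα₁, hσγ₁, hσV], ?_⟩
    simp only [g, add_sub_cancel_left, map_mul]
    exact mul_le_mul' le_rfl hVR
  have hS2 : ∀ f ∈ A, ∃ y ∈ S, Valued.v (f - y) ≤ Valued.v ϖ ^ ρ := by
    rintro f ⟨hσf, hf⟩
    -- the coordinate `u := (f − α₁) ∕ γ₁` is a fixed element of the ball
    set u : K := (f - α₁) * γ₁⁻¹ with hu
    have hσu : σ u = u := by rw [hu, map_mul, map_inv₀, map_sub, hσf, hσα₁, hσγ₁]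
    have hγu : γ₁ * u = f - α₁ := by rw [hu, mul_comm, mul_assoc, inv_mul_cancel₀ hγ0', mul_one]
    have huR : Valued.v u ≤ R := by
      have h1 : Valued.v γ₁ * Valued.v u ≤ Valued.v γ₁ * R := by rw [← map_mul, hγu]; exact hf
      exact (mul_le_mul_iff_right₀ hγpos).1 h1
    obtain ⟨V₀, hV₀D, hV₀⟩ := hD2 u hσu huR
    refine ⟨g V₀, mem_image.2 ⟨V₀, hV₀D, rfl⟩, ?_⟩
    have e1 : f - g V₀ = γ₁ * (u - V₀) := by simp only [g]; rw [mul_sub, hγu]; ring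
    rw [e1, map_mul, hρeq]
    exact mul_le_mul' le_rfl hV₀
  have hS3 : ∀ y ∈ S, ∀ y' ∈ S, Valued.v (y - y') ≤ Valued.v ϖ ^ ρ → y = y' := by
    intro y hy y' hy' hyy
    obtain ⟨V, hV, rfl⟩ := mem_image.1 hy
    obtain ⟨V', hV', rfl⟩ := mem_image.1 hy'
    have e1 : g V - g V' = γ₁ * (V - V') := by simp only [g]; ring
    rw [e1, map_mul, hρeq] at hyy
    rw [hD3 V hV V' hV' ((mul_le_mul_iff_right₀ hγpos).1 hyy)]
  have h0 := sum_normSign_repr_eq_zero hD h2v hρ hAu hAst S hS1 hS2 hS3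
  rwa [hSdef, sum_image hg_inj] at h0

/-! ## §2 HEAD — the K6 desk's radius-general, chart-free shape (WORD #5) -/

/-- **HEAD — «THE AFFINE LABEL CHARACTER SUMS TO ZERO OVER A COMPLETE DIGIT SYSTEM OF ANY FIXED BALL» (K6-(g), K6 desk LH4-p16 (g3) WORD #5 bytes).**  Ramified quadratic datum
`(σ, ϖ; d, t)` on a complete `K` with finite residue field, `|2| < 1`; `α₁, γ₁` fixed, `|α₁| = 1`, `|γ₁| = |ϖ|^{2c}`; a ball exponent `e` with `1 ≤ c + e` (the image ball
`α₁(1 + 𝔭_F^{c+e})` is strictly inside the unit level) and `c + e + 1 ≤ d` (it lies strictly above the conductor `𝔭_F^d`, i.e. reaches `U_F(2d−2)`); a resolution `n` with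
`2d − 1 ≤ 2c + n` (reaching the conductor); `D` a complete irredundant system of representatives of the fixed ball `|V| ≤ |ϖ|^{2e}` modulo `|ϖ|^n` (`hD1 hD2 hD3`).  THEN
**`Σ_{V ∈ D} normSign σ (α₁ + γ₁·V) = 0`** (§1 at `R := |ϖ|^{2e}`, `r := |ϖ|^n`). [cite: Serre1979, Ch. V §3 Cor. 3 pp. 84–86; Ch. XV §2] [cite: NeukirchANT1999, Ch. V (1.3)]
[cite: Kottwitz1986BaseChangeUnits, §1 pp. 240–241] [cite: Rogawski1990, §4.9 Prop. 4.9.1 (b) p. 55] -/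
theorem sum_normSign_affine_ballDigits_eq_zero [CompleteSpace K] [Finite 𝓀[K]] (hD : IsRamifiedQuadraticDatum σ ϖ d t) (h2v : Valued.v (2 : K) < 1)
    {α₁ γ₁ : K} (hσα₁ : σ α₁ = α₁) (hα₁ : Valued.v α₁ = 1) (hσγ₁ : σ γ₁ = γ₁) {c e : ℕ} (hγ₁ : Valued.v γ₁ = Valued.v ϖ ^ (2 * c))
    (hs1 : 1 ≤ c + e) (hsd : c + e + 1 ≤ d) {n : ℕ} (hn : 2 * d - 1 ≤ 2 * c + n)
    (D : Finset K) (hD1 : ∀ V ∈ D, σ V = V ∧ Valued.v V ≤ Valued.v ϖ ^ (2 * e))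
    (hD2 : ∀ V : K, σ V = V → Valued.v V ≤ Valued.v ϖ ^ (2 * e) → ∃ V₀ ∈ D, Valued.v (V - V₀) ≤ Valued.v ϖ ^ n)
    (hD3 : ∀ V ∈ D, ∀ V' ∈ D, Valued.v (V - V') ≤ Valued.v ϖ ^ n → V = V') :
    ∑ V ∈ D, normSign σ (α₁ + γ₁ * V) = 0 := by
  obtain ⟨-, -, hϖ, -, -, -, -⟩ := id hD
  have hpow : ∀ k : ℕ, Valued.v ϖ ^ k = exp (-(k : ℤ)) := fun k => by
    rw [hϖ, ← exp_nsmul, nsmul_eq_mul, mul_neg, mul_one]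
  refine sum_normSign_affine_ballSystem_eq_zero hD h2v hσα₁ hα₁ hσγ₁ (R := Valued.v ϖ ^ (2 * e)) (r := Valued.v ϖ ^ n) ?_ ?_ ?_ ?_ D hD1 hD2 hD3
  · rw [hγ₁, hpow, hpow, ← exp_add, ← exp_zero, exp_lt_exp]; omega
  · rw [hγ₁, hpow, hpow, ← exp_add, exp_le_exp]; omega
  · rw [hpow]; exact exp_ne_zero
  · rw [hγ₁, hpow, hpow, hpow, ← exp_add, exp_le_exp]; omega

/-! ## §3 COROLLARY — the socket's `Rd` letters: the digits of the ball inside ONE digit system of the unit ball -/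

/-- **COROLLARY — «THE WINDOW CHARACTER SUM VANISHES», SOCKET SHAPE (K6-(g), the `hω` letter of ★ p864409 `coreWindow_of_cellValues` at `B := Rd.filter (|·| ≤ |ϖ|^{2e})`).**
Frame of `sum_normSign_affine_ballDigits_eq_zero` (`hD h2v`, `α₁ γ₁` fixed, `|α₁| = 1`, `|γ₁| = |ϖ|^{2c}`, `1 ≤ c + e`, `c + e + 1 ≤ d`, `2d − 1 ≤ 2c + n`) and ONE digit system
`Rd` of fixed integral elements, complete and irredundant for the fixed unit ball modulo `|ϖ|^n` (`hRd1 hRd2 hRd3` — the letters of ★ p863833 ∕ ★ `…DiagonalCellBalancedCount` at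
`r := |ϖ|^n`), with `2e ≤ n` (the resolution is at least the ball's: a representative within `|ϖ|^n` of a ball element lies in the ball).  THEN
**`Σ_{V ∈ Rd.filter (fun V => |V| ≤ |ϖ|^{2e})} normSign σ (α₁ + γ₁·V) = 0`** — in the TOP chart of the row `e = 1, c = 0` (the inside window cells are the ball `|V| ≤ |ϖ_F|`),
in the INSIDE chart `e = 0, c = 1` (`Rd.filter (|·| ≤ 1) = Rd`). [cite: Serre1979, Ch. V §3 Cor. 3 pp. 84–86; Ch. XV §2] [cite: Kottwitz1986BaseChangeUnits, §1 pp. 240–241]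
[cite: Rogawski1990, §4.9 Prop. 4.9.1 (b) p. 55] -/
theorem sum_normSign_affine_filterBall_eq_zero [CompleteSpace K] [Finite 𝓀[K]] (hD : IsRamifiedQuadraticDatum σ ϖ d t) (h2v : Valued.v (2 : K) < 1)
    {α₁ γ₁ : K} (hσα₁ : σ α₁ = α₁) (hα₁ : Valued.v α₁ = 1) (hσγ₁ : σ γ₁ = γ₁) {c e : ℕ} (hγ₁ : Valued.v γ₁ = Valued.v ϖ ^ (2 * c))
    (hs1 : 1 ≤ c + e) (hsd : c + e + 1 ≤ d) {n : ℕ} (hn : 2 * d - 1 ≤ 2 * c + n)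
    (Rd : Finset K) (hRd1 : ∀ V ∈ Rd, σ V = V ∧ Valued.v V ≤ 1)
    (hRd2 : ∀ V : K, σ V = V → Valued.v V ≤ 1 → ∃ V₀ ∈ Rd, Valued.v (V - V₀) ≤ Valued.v ϖ ^ n)
    (hRd3 : ∀ V ∈ Rd, ∀ V' ∈ Rd, Valued.v (V - V') ≤ Valued.v ϖ ^ n → V = V') (hne : 2 * e ≤ n) :
    ∑ V ∈ Rd.filter (fun V => Valued.v V ≤ Valued.v ϖ ^ (2 * e)), normSign σ (α₁ + γ₁ * V) = 0 := by
  obtain ⟨-, -, hϖ, -, -, -, -⟩ := id hD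
  have hϖ1 : Valued.v ϖ ≤ 1 := by rw [hϖ, ← exp_zero, exp_le_exp]; norm_num
  have hball1 : Valued.v ϖ ^ (2 * e) ≤ 1 := pow_le_one₀ zero_le hϖ1
  have hres : Valued.v ϖ ^ n ≤ Valued.v ϖ ^ (2 * e) := pow_le_pow_right_of_le_one' hϖ1 hne
  refine sum_normSign_affine_ballDigits_eq_zero hD h2v hσα₁ hα₁ hσγ₁ hγ₁ hs1 hsd hn _ (fun V hV => ?_) (fun V hσV hVe => ?_) (fun V hV V' hV' hVV => ?_)
  · obtain ⟨hVR, hVe⟩ := mem_filter.1 hV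
    exact ⟨(hRd1 V hVR).1, hVe⟩
  · obtain ⟨V₀, hV₀R, hV₀⟩ := hRd2 V hσV (hVe.trans hball1)
    refine ⟨V₀, mem_filter.2 ⟨hV₀R, ?_⟩, hV₀⟩
    rw [show V₀ = V - (V - V₀) by ring]
    exact (Valuation.map_sub _ _ _).trans (max_le hVe (hV₀.trans hres))
  · exact hRd3 V (mem_filter.1 hV).1 V' (mem_filter.1 hV').1 hVV

end Summit.HodgeConjecture.HodgeConjecture.Cruxes.H413.F0P3cDyRamWindowLabelSumVanishes

end
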